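import Summits.MatrixMultiplication.MatrixMultiplication.Theorems.AbelianSTPPCensusShapeCertVPTables
import Summits.MatrixMultiplication.MatrixMultiplication.Theorems.AbelianSTPPCensusShapeCertSearch

/-!
# Abelian STPP census — soundness of `ShapeCertVP` (part 3: prefix aggregates versus the tail of an admissible family)

Cell mm-stpp, route `AbelianSTPPCensusVP`, crux `ShapeExclusionVP337` (stmt-MatrixMultiplication-19191); seat mm-stpp-theory.
This is lineage B's `…ShapeCertBudgets` (seat eng-2) transported verbatim to the records `shV` of the extended gain table
(the statements and proofs are eng-2's with `Above`/`WfL`/`shOf` replaced by `AboveV`/`WfV`/`shV`), plus the two tail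
budgets of `…ShapeCertSearch` (`tail_uu`, `tail_capOK`) and one new inequality: rule U11 at a fixed member `t` bounds
the packing weight of the WHOLE family, `2·Σ(ab+bc+ca) ≤ 3M + (a_t + b_t + c_t)` (`AboveV.two_sum_uu_le`).
-/

set_option linter.dupNamespace false -- `MatrixMultiplication.MatrixMultiplication` (summit = problem, D-0017)
set_option autoImplicit false

namespace Summit.MatrixMultiplication.MatrixMultiplication.Theorems.ShapeCertVP

open ShapeCert Multiset

section aggregates
/-! ### List aggregates are multiset sums -/
variable {M : ℕ} {fam : List Sh}

/-- a list aggregate of a well-formed prefix is the multiset sum of the matching triple function -/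
theorem agg_sum_eqV (hw : WfV M fam) (f : Sh → ℕ) (g : ℕ × ℕ × ℕ → ℕ) (hfg : ∀ x, f (shV M x) = g x) :
    (fam.map f).sum = ((famT fam).map g).sum := by
  unfold famT
  rw [Multiset.map_coe, Multiset.sum_coe, List.map_map]
  congr 1
  apply List.map_congr_left
  intro t ht
  simp only [Function.comp_apply]
  rw [← hfg t.tr, ← hw t ht]

/-- `gs` as a multiset sum -/
theorem gs_eqV (hw : WfV M fam) : gs fam = gsumV (famT fam) := agg_sum_eqV hw _ _ (shV_g M)
/-- `sA` as a multiset sum -/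
theorem sA_eqV (hw : WfV M fam) : sA fam = ((famT fam).map wa).sum := agg_sum_eqV hw _ _ (shV_wA M)
/-- `sB` as a multiset sum -/
theorem sB_eqV (hw : WfV M fam) : sB fam = ((famT fam).map wb).sum := agg_sum_eqV hw _ _ (shV_wB M)
/-- `sC` as a multiset sum -/
theorem sC_eqV (hw : WfV M fam) : sC fam = ((famT fam).map wc).sum := agg_sum_eqV hw _ _ (shV_wC M)
/-- `sab` as a multiset sum -/
theorem sab_eqV (hw : WfV M fam) : sab fam = ((famT fam).map pab).sum := agg_sum_eqV hw _ _ (shV_ab M)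
/-- `sbc` as a multiset sum -/
theorem sbc_eqV (hw : WfV M fam) : sbc fam = ((famT fam).map pbc).sum := agg_sum_eqV hw _ _ (shV_bc M)
/-- `sca` as a multiset sum -/
theorem sca_eqV (hw : WfV M fam) : sca fam = ((famT fam).map pca).sum := agg_sum_eqV hw _ _ (shV_ca M)


end aggregates

section budgets
/-! ### The tail of an admissible family above a prefix -/

variable {M : ℕ} {G : Multiset (ℕ × ℕ × ℕ)} {fam : List Sh}

/-- prefix members belong to the family -/
theorem AboveV.mem_G (h : AboveV M G fam) {t : Sh} (ht : t ∈ fam) : t.tr ∈ G :=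
  Multiset.mem_of_le h.le (tr_mem_famT ht)

/-- U11: the tail's `Σ a(b+c)` fits the prefix's budget -/
theorem AboveV.tail_wa (h : AboveV M G fam) : ((G - famT fam).map wa).sum + sA fam ≤ M + mnA fam M := by
  have hs := sum_map_split h.le wa
  rw [sA_eqV h.wf, add_comm, ← hs]
  apply le_add_mnA
  · rcases Multiset.empty_or_exists_mem G with hG | ⟨x, hx⟩
    · subst hG; simp
    · exact (h.adm.2.1 x hx).1.trans (by have := (h.univ x hx).a_le; omega)
  · intro t ht; have := (h.adm.2.1 t.tr (h.mem_G ht)).1; rwa [tr_fst] at this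

/-- U11: the tail's `Σ b(c+a)` fits the prefix's budget -/
theorem AboveV.tail_wb (h : AboveV M G fam) : ((G - famT fam).map wb).sum + sB fam ≤ M + mnB fam M := by
  have hs := sum_map_split h.le wb
  rw [sB_eqV h.wf, add_comm, ← hs]
  apply le_add_mnB
  · rcases Multiset.empty_or_exists_mem G with hG | ⟨x, hx⟩
    · subst hG; simp
    · exact (h.adm.2.1 x hx).2.1.trans (by have := (h.univ x hx).b_le; omega)
  · intro t ht; have := (h.adm.2.1 t.tr (h.mem_G ht)).2.1; rwa [tr_snd] at this

/-- U11: the tail's `Σ c(a+b)` fits the prefix's budget -/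
theorem AboveV.tail_wc (h : AboveV M G fam) : ((G - famT fam).map wc).sum + sC fam ≤ M + mnC fam M := by
  have hs := sum_map_split h.le wc
  rw [sC_eqV h.wf, add_comm, ← hs]
  apply le_add_mnC
  · rcases Multiset.empty_or_exists_mem G with hG | ⟨x, hx⟩
    · subst hG; simp
    · exact (h.adm.2.1 x hx).2.2.trans (by have := (h.univ x hx).c_le; omega)
  · intro t ht; have := (h.adm.2.1 t.tr (h.mem_G ht)).2.2; rwa [tr_thd] at this

/-- the erased-sum decomposition at a prefix member -/
theorem AboveV.erase_split (h : AboveV M G fam) {t : Sh} (ht : t ∈ fam) (f : ℕ × ℕ × ℕ → ℕ) :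
    ((G.erase t.tr).map f).sum + f t.tr = ((famT fam).map f).sum + ((G - famT fam).map f).sum := by
  have hmem := tr_mem_famT (fam := fam) ht
  have hG : G = famT fam + (G - famT fam) := by rw [add_comm, Multiset.sub_add_cancel h.le]
  have h1 : G.erase t.tr = (famT fam).erase t.tr + (G - famT fam) := by
    conv_lhs => rw [hG]
    exact Multiset.erase_add_left_pos _ hmem
  have h2 : ((famT fam).map f).sum = f t.tr + (((famT fam).erase t.tr).map f).sum := by
    conv_lhs => rw [← Multiset.cons_erase hmem]
    simp
  rw [h1, h2]; simp; ring

/-- U14 (`ab`): the tail's `Σ ab` fits under the prefix's largest offset -/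
theorem AboveV.tail_pab (h : AboveV M G fam) : ((G - famT fam).map pab).sum + dAB fam + sab fam ≤ M := by
  have hs := sum_map_split h.le pab
  have h2 : (G.map pab).sum ≤ M := h.adm.1.1
  rw [sab_eqV h.wf]
  have key : ∀ t ∈ fam, t.dab + ((famT fam).map pab).sum + ((G - famT fam).map pab).sum ≤ M := by
    intro t ht
    have hx := h.mem_G ht
    obtain ⟨⟨a1, a2⟩, -, -⟩ := h.adm.2.2.2.1 t.tr hx
    have hsp := h.erase_split ht pab
    have hpv := (h.univ _ hx).pab_le_vol
    rw [h.wf t ht, shV_dab]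
    by_cases hl : hasLCD (vol t.tr) M t.tr.2.2 = true
    · rw [if_pos hl]; omega
    · rw [if_neg hl]
      have : vol t.tr + ((G.erase t.tr).map pab).sum ≠ M := fun he => hl (a2 he)
      omega
  have hd : dAB fam ≤ M - (((famT fam).map pab).sum + ((G - famT fam).map pab).sum) :=
    dAB_le fun t ht => by have := key t ht; omega
  omega

/-- U14 (`bc`): the tail's `Σ bc` fits under the prefix's largest offset -/
theorem AboveV.tail_pbc (h : AboveV M G fam) : ((G - famT fam).map pbc).sum + dBC fam + sbc fam ≤ M := by
  have hs := sum_map_split h.le pbc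
  have h2 : (G.map pbc).sum ≤ M := h.adm.1.2.1
  rw [sbc_eqV h.wf]
  have key : ∀ t ∈ fam, t.dbc + ((famT fam).map pbc).sum + ((G - famT fam).map pbc).sum ≤ M := by
    intro t ht
    have hx := h.mem_G ht
    obtain ⟨-, ⟨b1, b2⟩, -⟩ := h.adm.2.2.2.1 t.tr hx
    have hsp := h.erase_split ht pbc
    have hpv := (h.univ _ hx).pbc_le_vol
    rw [h.wf t ht, shV_dbc]
    by_cases hl : hasLCD (vol t.tr) M t.tr.1 = true
    · rw [if_pos hl]; omega
    · rw [if_neg hl]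
      have : vol t.tr + ((G.erase t.tr).map pbc).sum ≠ M := fun he => hl (b2 he)
      omega
  have hd : dBC fam ≤ M - (((famT fam).map pbc).sum + ((G - famT fam).map pbc).sum) :=
    dBC_le fun t ht => by have := key t ht; omega
  omega

/-- U14 (`ca`): the tail's `Σ ca` fits under the prefix's largest offset -/
theorem AboveV.tail_pca (h : AboveV M G fam) : ((G - famT fam).map pca).sum + dCA fam + sca fam ≤ M := by
  have hs := sum_map_split h.le pca
  have h2 : (G.map pca).sum ≤ M := h.adm.1.2.2
  rw [sca_eqV h.wf]
  have key : ∀ t ∈ fam, t.dca + ((famT fam).map pca).sum + ((G - famT fam).map pca).sum ≤ M := by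
    intro t ht
    have hx := h.mem_G ht
    obtain ⟨-, -, ⟨c1, c2⟩⟩ := h.adm.2.2.2.1 t.tr hx
    have hsp := h.erase_split ht pca
    have hpv := (h.univ _ hx).pca_le_vol
    rw [h.wf t ht, shV_dca]
    by_cases hl : hasLCD (vol t.tr) M t.tr.2.1 = true
    · rw [if_pos hl]; omega
    · rw [if_neg hl]
      have : vol t.tr + ((G.erase t.tr).map pca).sum ≠ M := fun he => hl (c2 he)
      omega
  have hd : dCA fam ≤ M - (((famT fam).map pca).sum + ((G - famT fam).map pca).sum) :=
    dCA_le fun t ht => by have := key t ht; omega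
  omega

/-- volume cap: a tail member leaves room for the prefix's pair-product sums and largest pair product -/
theorem AboveV.tail_vol (h : AboveV M G fam) {x : ℕ × ℕ × ℕ} (hx : x ∈ G - famT fam) :
    vol x + sab fam ≤ M ∧ vol x + sbc fam ≤ M ∧ vol x + sca fam ≤ M ∧ vol x + mxP fam ≤ M := by
  have hxG := mem_G_of_tail hx
  have hle := le_erase_of_mem_sub h.le hx
  obtain ⟨⟨a1, -⟩, ⟨b1, -⟩, ⟨c1, -⟩⟩ := h.adm.2.2.2.1 x hxG
  have e1 := sum_map_le_of_le hle pab
  have e2 := sum_map_le_of_le hle pbc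
  have e3 := sum_map_le_of_le hle pca
  rw [← sab_eqV h.wf] at e1; rw [← sbc_eqV h.wf] at e2; rw [← sca_eqV h.wf] at e3
  have hv : vol x ≤ M := by have := (h.univ x hxG).vol_le; omega
  have e4 : mxP fam ≤ M - vol x := mxP_le fun t ht => by
    have h9 := h.adm.2.2.1 t.tr (h.mem_G ht) x (mem_erase_of_mem_sub h.le hx (tr_mem_famT ht))
    have hm := congrArg Sh.mpp (h.wf t ht); rw [shV_mpp] at hm
    omega
  omega

/-- a dead prefix has no tail -/
theorem AboveV.tail_eq_zero_of_dead (h : AboveV M G fam) (hd : (aggOf M fam).dead M = true) :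
    G - famT fam = 0 := by
  rcases Multiset.empty_or_exists_mem (G - famT fam) with h0 | ⟨x, hx⟩
  · exact h0
  exfalso
  have hxG := mem_G_of_tail hx
  have hU := h.univ x hxG
  have w1 := Multiset.le_sum_of_mem (Multiset.mem_map_of_mem wa hx)
  have w2 := Multiset.le_sum_of_mem (Multiset.mem_map_of_mem wb hx)
  have w3 := Multiset.le_sum_of_mem (Multiset.mem_map_of_mem wc hx)
  have t1 := h.tail_wa; have t2 := h.tail_wb; have t3 := h.tail_wc
  obtain ⟨v1, v2, v3, v4⟩ := h.tail_vol hx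
  have := hU.two_le_wa; have := hU.two_le_wb; have := hU.two_le_wc; have := hU.one_le_vol
  unfold Agg.dead Agg.ra Agg.rb Agg.rc Agg.vl Agg.mc aggOf at hd
  simp only [decide_eq_true_eq] at hd
  rcases hd with hd | hd | hd | hd
  · omega
  · omega
  · omega
  · have hm : max (max (sab fam) (max (sbc fam) (sca fam))) (mxP fam) ≤ M - vol x :=
      max_le (max_le (by omega) (max_le (by omega) (by omega))) (by omega)
    omega

end budgets


section more
/-! ### The packing budget, the volume bucket, and the first-member bound -/

variable {M : ℕ} {G : Multiset (ℕ × ℕ × ℕ)} {fam : List Sh}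

/-- the tail's packing weight fits the budget `q0` (eng-2's `Above.tail_uu`) -/
theorem AboveV.tail_uu (h : AboveV M G fam) : ((G - famT fam).map uu).sum ≤ (aggOf M fam).q0 M := by
  have p1 := h.tail_pab; have p2 := h.tail_pbc; have p3 := h.tail_pca
  have t1 := h.tail_wa; have t2 := h.tail_wb; have t3 := h.tail_wc
  have e1 := sum_uu_eq (G - famT fam); have e2 := sum_w_eq (G - famT fam)
  unfold Agg.q0 Agg.ra Agg.rb Agg.rc aggOf
  simp only
  refine le_min (by omega) ?_
  rw [Nat.le_div_iff_mul_le (by norm_num)]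
  omega

/-- every tail member fits the bucket `kOf` (eng-2's `Above.tail_capOK`) -/
theorem AboveV.tail_capOK (h : AboveV M G fam) {x : ℕ × ℕ × ℕ} (hx : x ∈ G - famT fam) :
    capOK ((aggOf M fam).kOf M) (vol x) = true := by
  have hxG := mem_G_of_tail hx
  have hU := h.univ x hxG
  obtain ⟨v1, v2, v3, v4⟩ := h.tail_vol hx
  have hq := h.tail_uu
  have ux : uu x ≤ ((G - famT fam).map uu).sum := Multiset.le_sum_of_mem (Multiset.mem_map_of_mem uu hx)
  have w1 := Multiset.le_sum_of_mem (Multiset.mem_map_of_mem wa hx)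
  have w2 := Multiset.le_sum_of_mem (Multiset.mem_map_of_mem wb hx)
  have w3 := Multiset.le_sum_of_mem (Multiset.mem_map_of_mem wc hx)
  have t1 := h.tail_wa; have t2 := h.tail_wb; have t3 := h.tail_wc
  unfold Agg.kOf
  refine capOK_min3 ?_ ?_ ?_
  · refine capOK_of_le ?_ (capOK_bucketOf _)
    unfold Agg.vl Agg.mc aggOf; simp only
    have : max (max (sab fam) (max (sbc fam) (sca fam))) (mxP fam) ≤ M - vol x :=
      max_le (max_le (by omega) (max_le (by omega) (by omega))) (by omega)
    omega
  · apply capOK_kU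
    have h27 := vol_sq_le_uu_cube x
    have : uu x ^ 3 ≤ (aggOf M fam).q0 M ^ 3 := Nat.pow_le_pow_left (ux.trans hq) 3
    omega
  · apply capOK_kR
    have ha : wa x ≤ (aggOf M fam).ra M := by unfold Agg.ra aggOf; simp only; omega
    have hb : wb x ≤ (aggOf M fam).rb M := by unfold Agg.rb aggOf; simp only; omega
    have hc : wc x ≤ (aggOf M fam).rc M := by unfold Agg.rc aggOf; simp only; omega
    have qa := hU.four_vol_le_wa_sq; have qb := hU.four_vol_le_wb_sq; have qc := hU.four_vol_le_wc_sq
    have ma := Nat.mul_self_le_mul_self ha; have mb := Nat.mul_self_le_mul_self hb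
    have mc := Nat.mul_self_le_mul_self hc
    rcases min_choice ((aggOf M fam).rb M) ((aggOf M fam).rc M) with e | e <;> rw [e] <;>
      rcases min_choice ((aggOf M fam).ra M) _ with e' | e' <;> rw [e'] <;> omega

/-- **the first-member bound**: rule U11 at a member `t` gives `2·Σ(ab+bc+ca) ≤ 3M + (a_t + b_t + c_t)` for the whole
family -/
theorem two_sum_uu_le {t : ℕ × ℕ × ℕ} (hA : AdmM M G) (ht : t ∈ G) :
    2 * (G.map uu).sum ≤ 3 * M + (t.1 + t.2.1 + t.2.2) := by
  obtain ⟨u1, u2, u3⟩ := hA.2.1 t ht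
  have e := sum_w_eq G
  omega

/-- aggregated: `Σuu` of the prefix is `uuA` of its aggregates -/
theorem uuA_aggOf (hw : WfV M fam) : uuA (aggOf M fam) = ((famT fam).map uu).sum := by
  unfold uuA aggOf; simp only
  rw [sab_eqV hw, sbc_eqV hw, sca_eqV hw, sum_uu_eq]

end more

end Summit.MatrixMultiplication.MatrixMultiplication.Theorems.ShapeCertVP
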